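import Literature.MathematicalPhysics.QuantumFieldTheory.Balaban1983to89.FlowStep

/-!
# `Balaban1983to89.BetaPertRigid` — the single-β̄ perturbative hypothesis `FlowStep.BetaPertH` is RIGID: together
with the printed one-loop split it forces the one-loop coefficient to be EXACTLY scale-independent

CITATION HEADER (lean-in-tree rule 2026-08-18).  Typed skeleton of the published series T. Bałaban, *Renormalization
group approach to lattice gauge field theories. I*, Commun. Math. Phys. **109**, 249–301 (1987) [Balaban1987RG1]
(cell paper B12; journal page = PDF page + 248) and *Large field renormalization. II*, Commun. Math. Phys. **122**,
355–392 (1989) [Balaban1989LargeFieldII] (B16).  WHAT IS REPRODUCED: nothing of the series is asserted or re-proved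
here; this module is an ADVERSARIAL CONSISTENCY CHECK (audit cell `pub-balaban`, unit `b2b-balaban-adv2`, gen 5) of
two of the cell's OWN typed hypotheses about the unprinted β-functions of (1.20)–(1.22) p. 264 / p. 298:

* `FlowStep.BetaPertH β β̄` — "∃ γ₀ C, ∀ γ ≤ γ₀ ∀ k ∀ v ∈ ]0,γ]^{k+1}, |β_{k+1}(v) − β̄| ≤ C γ²" with ONE
  k-independent β̄ (the cell's typing of [Balaban1989LargeFieldII] p. 355 "second order perturbative calculations");
* `B12Beta.OneLoopSplit β` — the split read off (2.12)–(2.14) p. 268: `β_{k+1} = β⁰_{k+1} + β¹_{k+1}(g_0,…,g_k)`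
  with `β⁰_{k+1}` coupling-FREE (the polarization of the Gaussian normalisation `log Z^{(k)}(U_{k+1})`, covariance
  `(C*Δ^{(k)}C)^{-1}`, p. 268) and `β¹_{k+1} = 0` at `g_k = 0` (p. 268 "the expression under the exponential above
  vanishes at g_k = 0").

RESULT (kernel-checked, elementary): if the remainder `β¹_{k+1}` merely TENDS TO 0 along constant histories
`(γ,…,γ)` as `γ → 0⁺` — in particular under the sub-cell's target (AF-1) `|β¹_{k+1}| ≤ C g_k` — then
`BetaPertH β β̄` forces `β⁰_{k+1} = β̄` for EVERY `k` (`beta0_eq_of_pert`); equivalently (`betaPertH_iff_const_quadratic`)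
`BetaPertH β β̄` ⟺ [the one-loop coefficients are all EQUAL to β̄] ∧ [the remainder is `O(γ²)` on the boxes,
uniformly in k].  Hence two scales with different one-loop coefficients refute `BetaPertH β β̄` for every β̄
(`not_betaPertH_of_two_scales`).  WHY IT MATTERS: the one-loop coefficient of a block-spin scheme on the lattice
`T_η`, `η = L^{-k}`, with `k` nested averaging constraints is a function of `k` (cell DIVERGENCE D-b12-3: "presumably
converge to β̄_∞ only as k → ∞"); `BetaPertH` as typed is therefore NOT the hypothesis that "second order perturbative
calculations" could discharge — the dischargeable form is `OneLoopSplit` + (AF-0) `inf_k β⁰_{k+1} > 0` + (AF-1), already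
consumed by `FlowStep.thm2Conclusion_of_split_hist` / `FlowStepRuns.thm2Printed_of_splitH`.  A typing audit, not a
statement about the series; no `sorry`/`axiom`; Mathlib + `FlowStep` only.
-/

namespace Literature.MathematicalPhysics.QuantumFieldTheory.Balaban1983to89.BetaPertRigid

open Literature.MathematicalPhysics.QuantumFieldTheory.Balaban1983to89
open FlowStep B12Beta

noncomputable section

variable {β : HBeta}

/-- The remainder `β¹_{k+1}` of the one-loop split tends to `0` along the constant histories `(γ,…,γ)` as `γ → 0⁺`,
for every scale `k` (no uniformity in `k` required).  The weakest reading of p. 268 "vanishes at g_k = 0" that has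
any quantitative content; implied by (AF-1), `remainderVanishes_of_af1`. [cite: Balaban1987RG1, (2.12)–(2.14) p.268] -/
def RemainderVanishes (S : OneLoopSplit β) : Prop :=
  ∀ k : ℕ, ∀ ε : ℝ, 0 < ε → ∃ δ : ℝ, 0 < δ ∧ ∀ γ : ℝ, 0 < γ → γ < δ → |S.β1 k (fun _ => γ)| ≤ ε

/-- The constant history `(γ,…,γ)` lies in the box `]0,γ]^{k+1}` for `γ > 0`. [folklore] -/
theorem const_mem_box {γ : ℝ} (hγ : 0 < γ) (k : ℕ) : (fun _ : Fin (k + 1) => γ) ∈ Box γ k :=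
  mem_box.mpr fun _ => ⟨hγ, le_rfl⟩

/-- (AF-1) on some box `]0,γ₁]^{k+1}` (the sub-cell's target: `|β¹_{k+1}(g_0,…,g_k)| ≤ C g_k`) implies
`RemainderVanishes`. [folklore] -/
theorem remainderVanishes_of_af1 (S : OneLoopSplit β) {C γ₁ : ℝ} (hγ₁ : 0 < γ₁) (hC : 0 ≤ C)
    (hAF1 : ∀ k (p : Fin (k + 1) → ℝ), p ∈ HistBox γ₁ k → |S.β1 k p| ≤ C * p (Fin.last k)) :
    RemainderVanishes S := by
  intro k ε hε
  refine ⟨min γ₁ (ε / (C + 1)), lt_min hγ₁ (by positivity), fun γ hγ hγδ => ?_⟩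
  have h1 : γ < γ₁ := lt_of_lt_of_le hγδ (min_le_left _ _)
  have h2 : γ < ε / (C + 1) := lt_of_lt_of_le hγδ (min_le_right _ _)
  have hmem : (fun _ : Fin (k + 1) => γ) ∈ HistBox γ₁ k := by
    rw [histBox_eq_box]; exact mem_box.mpr fun _ => ⟨hγ, h1.le⟩
  have := hAF1 k _ hmem
  calc |S.β1 k fun _ => γ| ≤ C * γ := this
    _ ≤ (C + 1) * γ := by nlinarith
    _ ≤ ε := by
        have := (lt_div_iff₀ (by positivity : (0:ℝ) < C + 1)).mp h2
        linarith

/-- **Rigidity.**  Under the printed one-loop split with a remainder that vanishes as `g → 0⁺`, the single-β̄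
perturbative hypothesis forces EVERY one-loop coefficient to equal `β̄`: `BetaPertH β β̄ → ∀ k, β⁰_{k+1} = β̄`.
Proof: at the constant history `(γ,…,γ)`, `|β⁰_{k+1} − β̄| ≤ |β_{k+1} − β̄| + |β¹_{k+1}| ≤ Cγ² + o(1) → 0`. [folklore] -/
theorem beta0_eq_of_pert (S : OneLoopSplit β) (hrem : RemainderVanishes S) {βbar : ℝ}
    (h : BetaPertH β βbar) : ∀ k, S.β0 k = βbar := by
  intro k
  obtain ⟨γ₀, hγ₀, C, hC, hP⟩ := h
  have key : ∀ ε : ℝ, 0 < ε → |S.β0 k - βbar| ≤ 0 + ε := by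
    intro ε hε
    obtain ⟨δ, hδ, hδε⟩ := hrem k (ε / 2) (by positivity)
    -- γ := min of γ₀, δ/2, 1, ε/(2(C+1)) : positive, ≤ γ₀, < δ, ≤ 1, and C γ² ≤ (C+1) γ ≤ ε/2
    set γ : ℝ := min (min γ₀ (δ / 2)) (min 1 (ε / (2 * (C + 1)))) with hγdef
    have hγpos : 0 < γ := by
      apply lt_min (lt_min hγ₀ (by positivity)) (lt_min one_pos (by positivity))
    have hγ₀' : γ ≤ γ₀ := (min_le_left _ _).trans (min_le_left _ _)
    have hγδ : γ < δ := lt_of_le_of_lt ((min_le_left _ _).trans (min_le_right _ _)) (by linarith)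
    have hγ1 : γ ≤ 1 := (min_le_right _ _).trans (min_le_left _ _)
    have hγε : γ ≤ ε / (2 * (C + 1)) := (min_le_right _ _).trans (min_le_right _ _)
    have hv := hP γ hγpos hγ₀' k _ (const_mem_box hγpos k)
    have hr := hδε γ hγpos hγδ
    have hsplit := S.split k (fun _ => γ)
    have hsq : C * γ ^ 2 ≤ ε / 2 := by
      have h1 : γ ^ 2 ≤ γ := by nlinarith
      have h2 : (C + 1) * γ ≤ ε / 2 := by
        have := (le_div_iff₀ (by positivity : (0:ℝ) < 2 * (C + 1))).mp hγε
        linarith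
      nlinarith
    have : |S.β0 k - βbar| ≤ |β k (fun _ => γ) - βbar| + |S.β1 k (fun _ => γ)| := by
      have e : S.β0 k - βbar = (β k (fun _ => γ) - βbar) - S.β1 k (fun _ => γ) := by rw [hsplit]; ring
      rw [e]; exact abs_sub _ _
    linarith
  have h0 : |S.β0 k - βbar| ≤ 0 := le_of_forall_pos_le_add key
  exact sub_eq_zero.mp (abs_nonpos_iff.mp h0)

/-- Two scales with DIFFERENT one-loop coefficients refute `BetaPertH β β̄` for every `β̄`. [folklore] -/
theorem not_betaPertH_of_two_scales (S : OneLoopSplit β) (hrem : RemainderVanishes S)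
    {k₁ k₂ : ℕ} (hne : S.β0 k₁ ≠ S.β0 k₂) : ∀ βbar : ℝ, ¬ BetaPertH β βbar := by
  intro βbar h
  have e := beta0_eq_of_pert S hrem h
  exact hne ((e k₁).trans (e k₂).symm)

/-- **Characterisation.**  Under the split with vanishing remainder, `BetaPertH β β̄` holds iff the one-loop
coefficients are all EQUAL to `β̄` and the remainder `β¹` is `O(γ²)` on the boxes uniformly in the scale.  So the
single-β̄ typing is exactly "scale-independent one-loop coefficient + quadratic remainder" — strictly stronger than
the sub-cell's (AF-0) `inf_k β⁰_{k+1} > 0` + (AF-1). [folklore] -/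
theorem betaPertH_iff_const_quadratic (S : OneLoopSplit β) (hrem : RemainderVanishes S) (βbar : ℝ) :
    BetaPertH β βbar ↔
      (∀ k, S.β0 k = βbar) ∧
        ∃ γ₀ : ℝ, 0 < γ₀ ∧ ∃ C : ℝ, 0 ≤ C ∧ ∀ γ, 0 < γ → γ ≤ γ₀ → ∀ k v, v ∈ Box γ k →
          |S.β1 k v| ≤ C * γ ^ 2 := by
  constructor
  · intro h
    refine ⟨beta0_eq_of_pert S hrem h, ?_⟩
    obtain ⟨γ₀, hγ₀, C, hC, hP⟩ := h
    refine ⟨γ₀, hγ₀, C, hC, fun γ hγ hγ₀' k v hv => ?_⟩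
    have hv' := hP γ hγ hγ₀' k v hv
    have e := beta0_eq_of_pert S hrem ⟨γ₀, hγ₀, C, hC, hP⟩ k
    have : β k v - βbar = S.β1 k v := by rw [S.split k v, e]; ring
    rwa [this] at hv'
  · rintro ⟨hconst, γ₀, hγ₀, C, hC, hQ⟩
    refine ⟨γ₀, hγ₀, C, hC, fun γ hγ hγ₀' k v hv => ?_⟩
    have : β k v - βbar = S.β1 k v := by rw [S.split k v, hconst k]; ring
    rw [this]; exact hQ γ hγ hγ₀' k v hv

end

end Literature.MathematicalPhysics.QuantumFieldTheory.Balaban1983to89.BetaPertRigid
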